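import Mathlib.Algebra.BigOperators.Ring.Finset
import Mathlib.Algebra.Order.BigOperators.Group.Finset
import Mathlib.Data.Fintype.BigOperators
import Mathlib.Data.Fintype.Pi
import Mathlib.Algebra.BigOperators.Pi
import Mathlib.Algebra.Ring.Parity
import Mathlib.Tactic.Positivity
import Mathlib.Tactic.Ring
import Mathlib.Tactic.Linarith
import Literature.Computability.Complexity.BooleanFourier
import Literature.Computability.QuantumComplexity.Forrelation
import Literature.Computability.QuantumComplexity.QueryComplexity
import HarnessLib

/-!
# Simon's algorithm: the Fourier-sampling sums over `(ℤ/2)ⁿ`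

Family `quantum-advantage` (trunk `CryptoQuantFine`), namespace `Literature.QuantumAdvantage.Simon`. The
combinatorics of the output distribution of Simon's subroutine "Fourier-twice" (Simon, FOCS 1994,
§3.1; journal version SIAM J. Comput. 1997) run `k` times in parallel, as consumed by the circuit
analysis `SimonCircuit.lean`:

* the character `(-1)^{s·u}` of `(ℤ/2)ⁿ` indexed by bit vectors is this namespace's
  `Literature.Computability.QuantumComplexity.twist` (`Forrelation.lean`: `twist x y = ∏ₗ (-1)^{xₗ yₗ}`, with
  `twist_comm`, `abs_twist`), *reused, not redefined*; it is identified with the Walsh character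
  `Literature.Probability.RandomGraphs.LowDegree.walsh` of `Literature/Probability/RandomGraphs/LowDegree` at the support of `s`
  (`twist_eq_walsh`), through which `±1`-valuedness (`twist_mul_self`, from `sgn_mul_self`) and
  the orthogonality relation `sum_twist` (`∑ᵤ (-1)^{s·u} = 2ⁿ [s = 0]`, from
  `sum_walsh_mul_walsh_index` of `Literature/Computability/Complexity/BooleanFourier`) are
  *derived*; new here are multiplicativity under xor (`twist_xor_left`), the parity form
  (`twist_eq_one_iff`: `(-1)^{s·u} = 1 ↔ EvenOverlap s u`), the block characters `chiK` on
  `({0,1}ⁿ)ᵏ` and their orthogonality `sum_chiK_mul_chiK`;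
* `sAmp F y a = ∑_{z : F z = a} χ(z, y)`, the (unnormalised) amplitude of the outcome "first
  registers `y`, value registers `a`" after Fourier-twice on `z ↦ F z` (Simon 1994, §3.1:
  "the amplitude … will be `2⁻ⁿ ∑ (-1)^{z·y}`"), and `sum_sum_sAmp_sq` (total mass);
* the two cases of Simon's analysis: `sAmp_eq_zero_of_periodic` ("if `y · s ≢ 0 (mod 2)` … the
  amplitude is `0`") and `sum_sAmp_sq_of_injective` ("if `f` is 1-to-1 … amplitudes will all be
  `2⁻ⁿ` up to phase"); the periodicity hypothesis is produced from `HasXorMask`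
  (`QueryComplexity.lean`) by `HasXorMask.apply_xor`;
* the acceptance predicate of the decision procedure, `MissesBasis y` ("the `k` samples have a
  common nonzero vector `s'` with `y_c · s' ≡ 0` for all `c`", i.e. they do not contain a basis of
  `(ℤ/2)ⁿ`; Simon 1994, §3.1, last paragraph), with `missesBasis_of_forall_even` and the union
  bound `card_filter_missesBasis_le` (`#{y : MissesBasis y} ≤ (2ⁿ - 1) · 2^{(n-1)k}`).

## References

* D. R. Simon, *On the power of quantum computation*, Proc. 35th FOCS (1994) 116–123, §3.1
  ("Problem: is a function invariant under some xor-mask?": Fourier-twice; the two cases; "`n/ε`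
  repetitions … will with probability … contain a basis") [Simon1994]; journal version SIAM J.
  Comput. 26(5) (1997) 1474–1483 [Simon1997]. Section numbers below are those of the FOCS text.
* R. de Wolf, *Quantum Computing: Lecture Notes*, arXiv:1907.09415, §3.2 [deWolf2019].
* R. O'Donnell, *Analysis of Boolean Functions* (2014), §1.4 (characters, orthogonality)
  [ODonnell2014].
* S. Aaronson, A. Ambainis, *Forrelation*, SIAM J. Comput. 47 (2018), §1.1.1 (the sign
  `(-1)^{x·y}`) [AaronsonAmbainis2018].
-/

namespace Literature.Computability.QuantumComplexity

namespace Simon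

open Finset

variable {n k : ℕ}

/-! ### From xor-masks to block periodicity -/

/-- A function with xor-mask `s` is invariant under xoring `s` into its argument (the direction of
Simon's promise consumed by the amplitude analysis). [Simon 1994, §3.1 ("`f(x) = f(x ⊕ s)`")] [cite: Simon1994, §3.1] -/
theorem _root_.Literature.Computability.QuantumComplexity.HasXorMask.apply_xor {F : (Fin n → Bool) → (Fin n → Bool)}
    {s : Fin n → Bool} (h : HasXorMask F s) (x : Fin n → Bool) : F (fun i => x i ^^ s i) = F x :=
  ((h x _).2 (Or.inr rfl)).symm

/-! ### The character `(-1)^{s·u}` (`twist`) and the Walsh characters -/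

/-- **Bridge**: the bit-vector-indexed character `twist s u = (-1)^{s·u}` of `Forrelation.lean` is
the Walsh character `walsh T u = ∏_{i ∈ T} (-1)^{uᵢ}` of `LowDegree.lean` at the support
`T = {i : sᵢ = 1}`. [O'Donnell 2014, §1.4; Aaronson–Ambainis 2018, §1.1.1] [folklore] -/
theorem twist_eq_walsh (s u : Fin n → Bool) :
    twist s u = Literature.Probability.RandomGraphs.LowDegree.walsh (univ.filter fun i => s i = true) u := by
  rw [twist, Literature.Computability.Complexity.LowDegree.walsh_eq_prod_ite]
  refine prod_congr rfl fun i _ => ?_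
  simp only [mem_filter, mem_univ, true_and]
  cases s i <;> cases u i <;> simp [Literature.Probability.RandomGraphs.LowDegree.sgn]

/-- `((-1)^{s·u})² = 1` (from `sgn_mul_self` through `twist_eq_walsh`). [folklore] -/
theorem twist_mul_self (s u : Fin n → Bool) : twist s u * twist s u = 1 := by
  rw [twist_eq_walsh, Literature.Probability.RandomGraphs.LowDegree.walsh, ← prod_mul_distrib]
  exact prod_eq_one fun i _ => Literature.Probability.RandomGraphs.LowDegree.sgn_mul_self (u i)

/-- `((-1)^{s·u})² = 1`. [folklore] -/
theorem twist_sq (s u : Fin n → Bool) : twist s u ^ 2 = 1 := by rw [sq, twist_mul_self]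

/-- `(-1)^{s·u} = ±1`. [folklore] -/
theorem twist_eq_one_or (s u : Fin n → Bool) : twist s u = 1 ∨ twist s u = -1 :=
  mul_self_eq_one_iff.1 (twist_mul_self s u)

/-- Multiplicativity: `(-1)^{(s ⊕ t)·u} = (-1)^{s·u} (-1)^{t·u}`. [Simon 1994, §3.1
("`(z ⊕ s) · y ≡ z·y ⊕ s·y`")] [cite: Simon1994, §3.1] -/
theorem twist_xor_left (s t u : Fin n → Bool) :
    twist (fun i => s i ^^ t i) u = twist s u * twist t u := by
  rw [twist, twist, twist, ← prod_mul_distrib]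
  refine prod_congr rfl fun i _ => ?_
  rcases Bool.eq_false_or_eq_true (s i) with hs | hs <;>
    rcases Bool.eq_false_or_eq_true (t i) with ht | ht <;>
      rcases Bool.eq_false_or_eq_true (u i) with hu | hu <;> simp [hs, ht, hu]

/-- The support of a bit vector is empty iff the vector is zero. [folklore] -/
theorem filter_eq_true_eq_empty_iff (s : Fin n → Bool) :
    (univ.filter fun i => s i = true) = ∅ ↔ s = fun _ => false := by
  simp only [filter_eq_empty_iff, mem_univ, true_implies, Bool.not_eq_true]
  exact ⟨fun h => funext h, fun h i => congrFun h i⟩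

/-- **Orthogonality**: `∑ᵤ (-1)^{s·u} = 2ⁿ` if `s = 0` and `0` otherwise — the case `T = ∅` of the
orthogonality of Walsh characters `sum_walsh_mul_walsh_index`, through `twist_eq_walsh`.
[O'Donnell 2014, §1.4; Simon 1994, §3.1 (the two cases of the amplitude computation)] [cite: ODonnell2014, §1.4] -/
theorem sum_twist (s : Fin n → Bool) :
    ∑ u : Fin n → Bool, twist s u = if s = (fun _ => false) then (2 : ℝ) ^ n else 0 := by
  classical
  have h := Literature.Computability.Complexity.LowDegree.sum_walsh_mul_walsh_index (univ.filter fun i => s i = true)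
    (∅ : Finset (Fin n))
  simp only [Literature.Probability.RandomGraphs.LowDegree.walsh_empty, mul_one] at h
  simp_rw [twist_eq_walsh]
  rw [h]
  exact if_congr (filter_eq_true_eq_empty_iff s) rfl rfl

/-- The overlap count of `s` and `u` is even (`s · u ≡ 0 (mod 2)`). [Simon 1994, §3.1] [cite: Simon1994, §3.1] -/
def EvenOverlap (s u : Fin n → Bool) : Prop := Even (univ.filter fun i => s i && u i).card

/-- Evenness of the overlap is decidable. [folklore] -/
instance (s u : Fin n → Bool) : Decidable (EvenOverlap s u) := by
  unfold EvenOverlap; infer_instance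

/-- `(-1)^{s·u} = (-1)^{#{i : sᵢ ∧ uᵢ}}`. [folklore] -/
theorem twist_eq_neg_one_pow (s u : Fin n → Bool) :
    twist s u = (-1) ^ (univ.filter fun i => s i && u i).card := by
  rw [twist, prod_ite, prod_const_one, mul_one, prod_const]

/-- `(-1)^{s·u} = 1` iff the overlap is even. [folklore] -/
theorem twist_eq_one_iff (s u : Fin n → Bool) : twist s u = 1 ↔ EvenOverlap s u := by
  rw [twist_eq_neg_one_pow, EvenOverlap]
  constructor
  · intro h
    by_contra hodd
    rw [Nat.not_even_iff_odd] at hodd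
    rw [hodd.neg_one_pow] at h
    norm_num at h
  · intro h; exact h.neg_one_pow

/-- `(-1)^{s·u} = -1` iff the overlap is odd. [folklore] -/
theorem twist_eq_neg_one_iff (s u : Fin n → Bool) : twist s u = -1 ↔ ¬ EvenOverlap s u := by
  rw [← twist_eq_one_iff]
  rcases twist_eq_one_or s u with h | h <;> rw [h] <;> norm_num

/-- For `s ≠ 0`, exactly half of `{0,1}ⁿ` has even overlap with `s` (the hypothesis forces
`n ≥ 1`). [folklore] -/
theorem card_filter_evenOverlap {s : Fin n → Bool} (hs : s ≠ fun _ => false) :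
    (univ.filter fun u : Fin n → Bool => EvenOverlap s u).card = 2 ^ (n - 1) := by
  classical
  -- `s ≠ 0` forces `n ≥ 1`
  have hn : 1 ≤ n := by
    rcases Nat.eq_zero_or_pos n with rfl | h
    · exact absurd (funext fun i => i.elim0) hs
    · exact h
  -- `#even - #odd = ∑ χ = 0` and `#even + #odd = 2ⁿ`
  have hsum : ∑ u : Fin n → Bool, twist s u = 0 := by rw [sum_twist, if_neg hs]
  have hsplit : ∑ u : Fin n → Bool, twist s u =
      ((univ.filter fun u : Fin n → Bool => EvenOverlap s u).card : ℝ) -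
        ((univ.filter fun u : Fin n → Bool => ¬ EvenOverlap s u).card : ℝ) := by
    rw [← sum_filter_add_sum_filter_not univ (fun u => EvenOverlap s u)]
    rw [sum_congr rfl (fun u hu => (twist_eq_one_iff s u).2 (mem_filter.1 hu).2),
      sum_congr rfl (fun u hu => (twist_eq_neg_one_iff s u).2 (mem_filter.1 hu).2)]
    simp [sub_eq_add_neg]
  have htot : (univ.filter fun u : Fin n → Bool => EvenOverlap s u).card +
      (univ.filter fun u : Fin n → Bool => ¬ EvenOverlap s u).card = 2 ^ n := by
    rw [card_filter_add_card_filter_not, card_univ, Fintype.card_fun, Fintype.card_bool,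
      Fintype.card_fin]
  have h2 : 2 ^ n = 2 * 2 ^ (n - 1) := by
    rw [← pow_succ']; congr 1; omega
  have heq : ((univ.filter fun u : Fin n → Bool => EvenOverlap s u).card : ℝ) =
      (univ.filter fun u : Fin n → Bool => ¬ EvenOverlap s u).card := by linarith
  have heq' : (univ.filter fun u : Fin n → Bool => EvenOverlap s u).card =
      (univ.filter fun u : Fin n → Bool => ¬ EvenOverlap s u).card := by exact_mod_cast heq
  omega

/-! ### Block characters on `({0,1}ⁿ)ᵏ` -/

/-- The character of `({0,1}ⁿ)ᵏ` indexed by `z`, at `y`: the product of the block characters.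
[Simon 1994, §3.1 (independent repetitions of Fourier-twice)] [cite: Simon1994, §3.1] -/
def chiK (z y : Fin k → Fin n → Bool) : ℝ := ∏ c, twist (z c) (y c)

/-- `χ_z(y) = ±1`. [folklore] -/
theorem chiK_eq_one_or (z y : Fin k → Fin n → Bool) : chiK z y = 1 ∨ chiK z y = -1 := by
  unfold chiK
  induction (univ : Finset (Fin k)) using Finset.induction_on with
  | empty => simp
  | insert c t hc ih =>
    rw [prod_insert hc]
    rcases ih with h | h <;> rw [h] <;> rcases twist_eq_one_or (z c) (y c) with h' | h' <;> rw [h'] <;>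
      norm_num

/-- `χ_z(y)² = 1`. [folklore] -/
theorem chiK_sq (z y : Fin k → Fin n → Bool) : chiK z y ^ 2 = 1 := by
  rcases chiK_eq_one_or z y with h | h <;> rw [h] <;> norm_num

/-- Multiplicativity of block characters. [folklore] -/
theorem chiK_xor_left (z z' y : Fin k → Fin n → Bool) :
    chiK (fun c i => z c i ^^ z' c i) y = chiK z y * chiK z' y := by
  unfold chiK
  rw [← prod_mul_distrib]
  exact prod_congr rfl fun c _ => twist_xor_left (z c) (z' c) (y c)

/-- Xoring the mask `s` into block `c` multiplies the character by `(-1)^{s·y_c}`.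
[Simon 1994, §3.1 ("`(z ⊕ s)·y ≡ z·y ⊕ s·y`")] [cite: Simon1994, §3.1] -/
theorem chiK_update_xor (z y : Fin k → Fin n → Bool) (c : Fin k) (s : Fin n → Bool) :
    chiK (Function.update z c fun i => z c i ^^ s i) y = chiK z y * twist s (y c) := by
  classical
  unfold chiK
  rw [← prod_erase_mul _ _ (mem_univ c), ← prod_erase_mul univ (fun c => twist (z c) (y c)) (mem_univ c),
    Function.update_self, twist_xor_left, mul_assoc]
  congr 1
  exact prod_congr rfl fun c' hc' => by rw [Function.update_of_ne (ne_of_mem_erase hc')]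

/-- **Orthogonality of block characters**: `∑_y χ_z(y) χ_{z'}(y) = 2^{kn} [z = z']` (from
`sum_twist` blockwise). [O'Donnell 2014, §1.4] [folklore] -/
theorem sum_chiK_mul_chiK (z z' : Fin k → Fin n → Bool) :
    ∑ y : Fin k → Fin n → Bool, chiK z y * chiK z' y =
      if z = z' then (2 : ℝ) ^ (k * n) else 0 := by
  classical
  simp_rw [← chiK_xor_left]
  unfold chiK
  have h := (Finset.prod_univ_sum (fun _ : Fin k => (univ : Finset (Fin n → Bool)))
    (fun c u => twist (fun i => z c i ^^ z' c i) u)).symm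
  rw [Fintype.piFinset_univ] at h
  rw [h]
  simp_rw [sum_twist]
  split_ifs with hzz
  · subst hzz
    have h1 : ∀ c : Fin k, (fun i => z c i ^^ z c i) = fun _ => false := fun c => by
      funext i; simp
    simp only [h1, if_true, prod_const, card_univ, Fintype.card_fin]
    rw [← pow_mul, Nat.mul_comm]
  · have : ∃ c, (fun i => z c i ^^ z' c i) ≠ fun _ => false := by
      by_contra hc
      push Not at hc
      apply hzz
      funext c i
      have := congrFun (hc c) i
      revert this
      cases z c i <;> cases z' c i <;> simp
    obtain ⟨c, hc⟩ := this
    exact prod_eq_zero (mem_univ c) (if_neg hc)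

/-! ### The amplitudes of parallel Fourier-twice -/

/-- The unnormalised amplitude of the outcome (`y` on the query registers, `a` on the value
registers) after running Fourier-twice in parallel on the `k` blocks of `z ↦ F z`:
`∑_{z : F z = a} χ_z(y)` (the actual amplitude is `2^{-kn}` times this).
[Simon 1994, §3.1 ("the amplitude of this configuration will be `2⁻ⁿ ∑ …`")] [cite: Simon1994, §3.1] -/
noncomputable def sAmp (F : (Fin k → Fin n → Bool) → (Fin k → Fin n → Bool))
    (y a : Fin k → Fin n → Bool) : ℝ :=
  ∑ z : Fin k → Fin n → Bool, if F z = a then chiK z y else 0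

/-- **Total mass (Parseval)**: `∑_a ∑_y sAmp² = 2^{kn} · 2^{kn}`. [folklore] [cite: Simon1994, §3.1] -/
theorem sum_sum_sAmp_sq (F : (Fin k → Fin n → Bool) → (Fin k → Fin n → Bool)) :
    ∑ a : Fin k → Fin n → Bool, ∑ y : Fin k → Fin n → Bool, sAmp F y a ^ 2 =
      (2 : ℝ) ^ (k * n) * 2 ^ (k * n) := by
  classical
  -- expand the square, swap sums, use orthogonality
  have hexp : ∀ a y : Fin k → Fin n → Bool, sAmp F y a ^ 2 =
      ∑ z : Fin k → Fin n → Bool, ∑ z' : Fin k → Fin n → Bool,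
        (if F z = a then 1 else 0) * (if F z' = a then 1 else 0) * (chiK z y * chiK z' y) := by
    intro a y
    rw [sAmp, sq, sum_mul_sum]
    refine sum_congr rfl fun z _ => sum_congr rfl fun z' _ => ?_
    split_ifs <;> ring
  simp_rw [hexp]
  have hswap : ∀ a : Fin k → Fin n → Bool,
      ∑ y : Fin k → Fin n → Bool, ∑ z : Fin k → Fin n → Bool, ∑ z' : Fin k → Fin n → Bool,
        (if F z = a then 1 else 0) * (if F z' = a then 1 else 0) * (chiK z y * chiK z' y) =
      ∑ z : Fin k → Fin n → Bool, (if F z = a then (2 : ℝ) ^ (k * n) else 0) := by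
    intro a
    rw [sum_comm]
    refine sum_congr rfl fun z _ => ?_
    rw [sum_comm]
    simp_rw [← mul_sum, sum_chiK_mul_chiK]
    rw [sum_eq_single z]
    · by_cases hz : F z = a <;> simp [hz]
    · intro z' _ hz'; rw [if_neg (Ne.symm hz')]; ring
    · intro h; exact absurd (mem_univ z) h
  simp_rw [hswap]
  rw [sum_comm]
  have : ∀ z : Fin k → Fin n → Bool,
      ∑ a : Fin k → Fin n → Bool, (if F z = a then (2 : ℝ) ^ (k * n) else 0) = 2 ^ (k * n) := by
    intro z; rw [sum_ite_eq]; simp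
  simp_rw [this]
  rw [sum_const, card_univ, Fintype.card_fun, Fintype.card_fun, Fintype.card_bool,
    Fintype.card_fin, Fintype.card_fin, nsmul_eq_mul]
  push_cast
  rw [← pow_mul]
  ring

/-- **The periodic case**: if `F` is invariant under xoring `s` into any block, then the
amplitude of every `y` having a block with odd overlap with `s` vanishes (pair `z` with
`z ⊕_c s`). [Simon 1994, §3.1 ("if `y · s ≡ 0 (mod 2)` … otherwise `α(z,y) = 0`")] [cite: Simon1994, §3.1] -/
theorem sAmp_eq_zero_of_periodic {F : (Fin k → Fin n → Bool) → (Fin k → Fin n → Bool)}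
    {s : Fin n → Bool} (hF : ∀ z c, F (Function.update z c fun i => z c i ^^ s i) = F z)
    {y : Fin k → Fin n → Bool} {c : Fin k} (hc : twist s (y c) = -1) (a : Fin k → Fin n → Bool) :
    sAmp F y a = 0 := by
  classical
  -- the involution `z ↦ z ⊕_c s` negates every term
  set τ : (Fin k → Fin n → Bool) → (Fin k → Fin n → Bool) :=
    fun z => Function.update z c fun i => z c i ^^ s i with hτ
  have hinv : Function.Involutive τ := by
    intro z
    simp only [hτ]
    funext c' i
    by_cases h : c' = c
    · subst h; simp
    · simp [Function.update_of_ne h]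
  have hS : sAmp F y a = -sAmp F y a := by
    unfold sAmp
    conv_lhs => rw [← Equiv.sum_comp hinv.toPerm]
    rw [← sum_neg_distrib]
    refine sum_congr rfl fun z _ => ?_
    change (if F (τ z) = a then chiK (τ z) y else 0) = -(if F z = a then chiK z y else 0)
    rw [show F (τ z) = F z from hF z c, show chiK (τ z) y = chiK z y * twist s (y c) from
      chiK_update_xor z y c s, hc]
    split_ifs <;> ring
  linarith

/-- **The injective case**: if `F` is injective then `sAmp F y a = ±[a ∈ range F]`, so
`∑_a sAmp² = 2^{kn}` for every `y`. [Simon 1994, §3.1 ("Suppose `f` is 1-to-1. Then … their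
amplitudes will therefore all be `2⁻ⁿ`, up to phase")] [cite: Simon1994, §3.1] -/
theorem sum_sAmp_sq_of_injective {F : (Fin k → Fin n → Bool) → (Fin k → Fin n → Bool)}
    (hF : Function.Injective F) (y : Fin k → Fin n → Bool) :
    ∑ a : Fin k → Fin n → Bool, sAmp F y a ^ 2 = (2 : ℝ) ^ (k * n) := by
  classical
  have hval : ∀ a, sAmp F y a ^ 2 = if a ∈ univ.image F then 1 else 0 := by
    intro a
    split_ifs with ha
    · obtain ⟨z, -, rfl⟩ := mem_image.1 ha
      unfold sAmp
      rw [sum_eq_single z]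
      · rw [if_pos rfl, chiK_sq]
      · intro z' _ hz'; rw [if_neg (fun h => hz' (hF h))]
      · intro h; exact absurd (mem_univ z) h
    · unfold sAmp
      rw [sum_eq_zero]
      · ring
      · intro z _; rw [if_neg]; exact fun h => ha (mem_image.2 ⟨z, mem_univ _, h⟩)
  simp_rw [hval]
  rw [← sum_filter, sum_const, nsmul_eq_mul, mul_one]
  have : (univ.filter fun a => a ∈ univ.image F) = univ.image F := by
    ext a; simp
  rw [this, card_image_of_injective _ hF, card_univ, Fintype.card_fun, Fintype.card_fun,
    Fintype.card_bool, Fintype.card_fin, Fintype.card_fin]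
  push_cast
  rw [← pow_mul, Nat.mul_comm]

/-! ### The acceptance predicate: the samples miss a nonzero orthogonal vector -/

/-- **The acceptance predicate of the decision procedure** on `k` samples `y₀, …, y_{k-1}` of
Fourier-twice: some nonzero `s'` has even overlap with every sample, i.e. the samples do not span
`(ℤ/2)ⁿ` (in the periodic case the hidden `s` is such a vector; in the injective case this is
exponentially unlikely). [Simon 1994, §3.1 (last paragraph: the outputs "contain a basis" vs.
"all satisfy `y · s ≡ 0`")] [cite: Simon1994, §3.1] -/
def MissesBasis (y : Fin k → Fin n → Bool) : Prop :=
  ∃ s : Fin n → Bool, s ≠ (fun _ => false) ∧ ∀ c, EvenOverlap s (y c)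

/-- The acceptance predicate is decidable. [folklore] -/
instance (y : Fin k → Fin n → Bool) : Decidable (MissesBasis y) := by
  unfold MissesBasis; infer_instance

/-- With `n = 0` there is no nonzero vector, so no sample tuple is accepted. [folklore] -/
theorem not_missesBasis_zero {y : Fin k → Fin 0 → Bool} : ¬ MissesBasis y :=
  fun ⟨_, hs, _⟩ => hs (funext fun i => i.elim0)

/-- In the periodic case every `y` with nonvanishing amplitude is accepted: if all blocks of `y`
have even overlap with the nonzero period `s`, `MissesBasis` holds with witness `s`. [cite: Simon1994, §3.1] -/
theorem missesBasis_of_forall_even {s : Fin n → Bool} (hs : s ≠ fun _ => false)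
    {y : Fin k → Fin n → Bool} (h : ∀ c, EvenOverlap s (y c)) : MissesBasis y :=
  ⟨s, hs, h⟩

/-- The set of sample tuples all of whose blocks have even overlap with `s` is a product set.
[folklore] -/
theorem card_filter_forall_even (s : Fin n → Bool) :
    (univ.filter fun y : Fin k → Fin n → Bool => ∀ c, EvenOverlap s (y c)).card =
      (univ.filter fun u : Fin n → Bool => EvenOverlap s u).card ^ k := by
  classical
  have : (univ.filter fun y : Fin k → Fin n → Bool => ∀ c, EvenOverlap s (y c)) =
      Fintype.piFinset fun _ : Fin k => univ.filter fun u : Fin n → Bool => EvenOverlap s u := by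
    ext y; simp [Fintype.mem_piFinset]
  rw [this, Fintype.card_piFinset, prod_const, card_univ, Fintype.card_fin]

/-- **Union bound for the injective case**: at most `(2ⁿ - 1) · 2^{(n-1)k}` sample tuples are
accepted (for each of the `2ⁿ - 1` nonzero `s'`, each block lies in the hyperplane `s'^⊥` of
size `2^{n-1}`; for `n = 0` there is no nonzero `s'` and both sides are `0`). [Simon 1994, §3.1 ("will with probability `1 - 2^{…}` contain a basis")] [cite: Simon1994, §3.1] -/
theorem card_filter_missesBasis_le :
    (univ.filter fun y : Fin k → Fin n → Bool => MissesBasis y).card ≤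
      (2 ^ n - 1) * 2 ^ ((n - 1) * k) := by
  classical
  set S := univ.filter (fun s : Fin n → Bool => s ≠ fun _ => false) with hS
  have hsub : (univ.filter fun y : Fin k → Fin n → Bool => MissesBasis y) ⊆
      S.biUnion fun s => univ.filter fun y : Fin k → Fin n → Bool => ∀ c, EvenOverlap s (y c) := by
    intro y hy
    obtain ⟨s, hs, h⟩ := (mem_filter.1 hy).2
    exact mem_biUnion.2 ⟨s, mem_filter.2 ⟨mem_univ _, hs⟩, mem_filter.2 ⟨mem_univ _, h⟩⟩
  refine (card_le_card hsub).trans ((card_biUnion_le).trans ?_)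
  have hterm : ∀ s ∈ S, (univ.filter fun y : Fin k → Fin n → Bool => ∀ c, EvenOverlap s (y c)).card =
      2 ^ ((n - 1) * k) := by
    intro s hs
    rw [card_filter_forall_even, card_filter_evenOverlap (mem_filter.1 hs).2, ← pow_mul]
  rw [sum_congr rfl hterm, sum_const, smul_eq_mul]
  refine Nat.mul_le_mul_right _ (le_of_eq ?_)
  have h : S = univ.erase (fun _ => false) := by ext s; simp [hS, mem_erase, and_comm]
  rw [h, card_erase_of_mem (mem_univ _), card_univ, Fintype.card_fun, Fintype.card_bool,
    Fintype.card_fin]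

/-! ### The two acceptance sums -/

/-- **Periodic case, total acceptance**: if `F` is invariant under xoring the nonzero `s` into
any block, the accepted mass is the whole mass `4^{kn}`. [Simon 1994, §3.1] [cite: Simon1994, §3.1] -/
theorem sum_missesBasis_sAmp_sq_of_periodic {F : (Fin k → Fin n → Bool) → (Fin k → Fin n → Bool)}
    {s : Fin n → Bool} (hs : s ≠ fun _ => false)
    (hF : ∀ z c, F (Function.update z c fun i => z c i ^^ s i) = F z) :
    ∑ y : Fin k → Fin n → Bool, ∑ a : Fin k → Fin n → Bool,
        (if MissesBasis y then sAmp F y a ^ 2 else 0) = (2 : ℝ) ^ (k * n) * 2 ^ (k * n) := by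
  classical
  calc ∑ y : Fin k → Fin n → Bool, ∑ a : Fin k → Fin n → Bool,
        (if MissesBasis y then sAmp F y a ^ 2 else 0)
      = ∑ y : Fin k → Fin n → Bool, ∑ a : Fin k → Fin n → Bool, sAmp F y a ^ 2 := by
        refine sum_congr rfl fun y _ => sum_congr rfl fun a _ => ?_
        split_ifs with hy
        · rfl
        · -- some block has odd overlap with `s`, so the amplitude vanishes
          have : ∃ c, ¬ EvenOverlap s (y c) := by
            by_contra hc; push Not at hc; exact hy (missesBasis_of_forall_even hs hc)
          obtain ⟨c, hc⟩ := this
          rw [sAmp_eq_zero_of_periodic hF ((twist_eq_neg_one_iff s (y c)).2 hc) a]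
          ring
    _ = ∑ a : Fin k → Fin n → Bool, ∑ y : Fin k → Fin n → Bool, sAmp F y a ^ 2 := sum_comm
    _ = _ := sum_sum_sAmp_sq F

/-- **Injective case, accepted mass**: if `F` is injective, the accepted mass is at most
`2^{kn} · (2ⁿ - 1) · 2^{(n-1)k}` (for `n = 0` both sides vanish, `not_missesBasis_zero`). [Simon 1994, §3.1] [cite: Simon1994, §3.1] -/
theorem sum_missesBasis_sAmp_sq_of_injective {F : (Fin k → Fin n → Bool) → (Fin k → Fin n → Bool)}
    (hF : Function.Injective F) :
    ∑ y : Fin k → Fin n → Bool, ∑ a : Fin k → Fin n → Bool,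
        (if MissesBasis y then sAmp F y a ^ 2 else 0) ≤
      (2 : ℝ) ^ (k * n) * (((2 ^ n - 1) * 2 ^ ((n - 1) * k) : ℕ) : ℝ) := by
  classical
  have hrow : ∀ y : Fin k → Fin n → Bool,
      ∑ a : Fin k → Fin n → Bool, (if MissesBasis y then sAmp F y a ^ 2 else 0) =
        if MissesBasis y then (2 : ℝ) ^ (k * n) else 0 := by
    intro y
    split_ifs
    · exact sum_sAmp_sq_of_injective hF y
    · simp
  simp_rw [hrow]
  rw [← sum_filter, sum_const, nsmul_eq_mul, mul_comm]
  refine mul_le_mul_of_nonneg_left ?_ (by positivity)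
  exact_mod_cast card_filter_missesBasis_le

end Simon

end Literature.Computability.QuantumComplexity
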